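import Summits.QuantumFields.BalabanUV.T4Continuum.Support.ShellMeasureWilsonGaugeInvariantSUN
import Summits.QuantumFields.BalabanUV.T4Continuum.Support.ShellMeasureWilsonExterior

/-!
# `T4Continuum.ShellMeasureWilsonExteriorSUN` — (M1)₀ REALIZED for `G = SU(N)`, EVERY `N`, GAUGE-INVARIANT DENSITY,
# NO BOND WINDOW, with a BLOCK-BLIND gauge-invariant EXTERIOR FACTOR riding free: leaf-10's
# `ShellMeasureWilsonGaugeInvariantSUN.slotAntiConcentration_wilson_suN_gaugeInvariant` with `G · giF`
# (cell `pub-balaban`, sub-cell `t4`, spine estimate NE7c (node U5b); NE7c ROUND-2 crew `t4-ne7c-formalise-*`, unit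
# `b2b-balaban-t4-ne7c-formalise-leaf-06` gen 3, file 1 of the OFFER «S19 FOR SU(N) — THE LEVEL-0 FACE OF RECORD FOR
# SU(N)» (journal; the owner t4-ne7c-p1 books / renumbers / refuses); c5-OPTIONAL SU(N) orbit — SU(2) is the row's
# certified instance; ADDITIVE — imports leaf-10's `ShellMeasureWilsonGaugeInvariantSUN` (p217538; hence S34
# `ShellMeasureWilsonRealizedSUN(Words)`, S43 `ShellMeasureAxialReachSUN`, S31 `ShellMeasureRootCompositionSUN`, S11 f1
# `ShellMeasureLevelZeroWords`) and row S2's `ShellMeasureWilsonExterior` (p208589, for its GENERIC §1 blindness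
# lemmas) only; 0 `def`, 0 sorry, 0 cite tags)

HONEST FRAMING.  Finite four-torus programme, rung (B)+1 only — NOT infinite volume, NOT a mass gap, NOT the Clay
problem, NOT summit progress; (B), `BetaPertHyp`, (B^μ) not consumed.  NE7c NOT PRINTED, NOT PROVED; «NE7c ⇐ the
named binders» (trigger c3); (M1)₀ realized ≠ NE7c; (M1) for Bałaban's effective measures NOT PRINTED (G-ne7cp1-1);
SU(2) is the certified instance (c5).
WHY THIS FILE.  Exactly row S2 f2's reason (`ShellMeasureWilsonExterior`), now for `SU(N)`: in the realized level-0
slot measure the factors that do not read the block's chart bonds `Λ` — the Wilson weight of the plaquettes NOT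
meeting `Λ`, exterior co-tests — ride FREE because they are constant along the block contraction of every tree-gauged
exterior section; the level-0 face OF RECORD (file 2 `ShellMeasureWilsonLedgerSUN`, row S19's pattern) needs the
exterior Wilson weight inside the (M1)₀ statement before the box test can be traded for it on the shell.  Leaf-10's
`slotAntiConcentration_wilson_suN_gaugeInvariant` is stated for the density `giF` alone; this file re-runs ITS proof
(END-II for `SU(N)` `ShellMeasureRootCompositionSUN.slotAC_realized_suN_of_levelData_ball` INHABITED with the level-0
data, the window factorisation `hFw` DISCHARGED by S43's `ShellMeasureAxialReachSUN.windowSU_fixTo_comb_eq_one` — the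
proof text of §2 is leaf-10-g7's §4, itself S11 §2's `ShellMeasureRootCompositionLevelZero` word for word at `SUN N`,
adapted) for the density `G · giF` with ANY measurable, gauge-invariant, `Λ`-BLIND factor `G ≤ 1`, with the SAME
constant: the factor is the constant `G(V[comb := 1])` of the tree-gauged section
(`ShellMeasureHeadlines.fixTo_updateFinset_of_disjoint`) and is threaded through END-II's kept-co-test slot `Jco`
(support `hJW` and centre-monotonicity `hJ` survive multiplication by a section constant, finiteness `hfin` by `G ≤ 1`,
the dictionary `hRdict` by reassociation).  A transport of a blind factor at the REALIZED level is false in general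
(per-section (M1) is what a section constant preserves, and it lives inside END-II) — hence the re-inhabitation.
0 sorry, 0 citations.  HONEST DEPENDENCY (cell): continuum YM on T⁴ ⇐ BetaPertH ∧ nine spine estimates (0/9 proved);
BetaPertH ⇐ (D1) ∧ (D4) ∧ CAP+tail; G-an2-4 gates asym, D1 and NE2/3/4.

WHAT IS PROVED (all [folklore]).  §1 `exteriorWilson_admissible` packages the concrete exterior factor
`e^{−β Σ_{P_ext}}` (`P_ext` avoiding `Λ`): measurable, gauge invariant, `Λ`-blind, `≤ 1` (row S2 f2's GENERIC §1 BY
NAME).  §2 `slotAntiConcentration_wilson_suN_gaugeInvariant_exterior`: leaf-10's hypotheses (non-wrapping box `[lo, hi]`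
of side `≤ m`, chart bonds `Λ` = box bonds off the axial comb, window `0 ≤ S ≤ 1/4`, co-test threshold `σ > 0` with the
`SU(N)` reach `N(d−1)mσ < 4`, `√N(π/2)(d−1)mσ ≤ S`, classifier plaquettes `∅ ≠ P_u ⊆ boxPlaqs`, weight plaquettes
`P_w`, `β ≥ 0`, `θ > 0`, `0 ≤ δ < 1`, `0 ≤ ρ ≤ (1−δ)/2`, free `Rad > 1`, (SM)₀ `36(e^{4S·Rad} − 1)/(Rad−1)² ≤ δθ`, (SM)_σ
`4(4S)²e^{8S} ≤ δσ`) + `G` measurable, gauge invariant, `Λ`-blind, `≤ 1` ⟹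
`SlotAntiConcentration ((fieldMeasure P j SU(N)).withDensity (G · giF lo hi σ β P_w)) (max_{p∈P_u} dist1 U(∂p)) θ ρ
(2(#Λ·d_N + β·#P_w·4S(8+16S))/(1−δ))`; `…_exteriorWilson` — the instance `G = e^{−β Σ_{P_ext}}`.

WHAT THIS DOES NOT DO.  (MR)₀'s mass ratio (row S2; not needed for the face of record, file 2); anything at `j ≥ 1`;
SU(2)'s certified face (rows S1/S2/S19, gnomonic chart — this is NOT its `N = 2` instance); NE7c NOT proved; 0/9 spine.
-/

noncomputable section

open NormedSpace Set Function MeasureTheory Metric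

namespace Summit.QuantumFields.BalabanUV.T4Continuum.ShellMeasureWilsonExteriorSUN

open scoped ENNReal Matrix.Norms.L2Operator
open Literature.MathematicalPhysics.QuantumFieldTheory.Balaban1983to89
open GaugeField (GaugeInvariant)
open T4ShellMeasure (SlotAntiConcentration)
open T4ShellMeasureDet (blockLaw)
open T4TreeGaugeFixing (fixTo measurable_fixTo noClosedLoop_combBonds)
open T4AxialGaugeFixing (combBonds)
open T4AxialGaugeSmallField (boxPlaqs boxBonds)
open ShellMeasureExpChartSUN
open ShellMeasureWilsonWords (scale normSum wordExp coreMap_word interpConst_mono normSum_nonneg scale_one)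
open ShellMeasureWilsonTrace (Letter wordEval sGen dFro)
open ShellMeasureWilsonMoving (mwordEval)
open ShellMeasureWilsonBlock (matrixTrace matrixTrace_N_pos wilson_dictionary_specialUnitaryGroup)
open ShellMeasureLevelAssembly (classifier weight action)
open ShellMeasureLevelZeroWords (classifierWitness_linear exists_graded_of_word)
open ShellMeasureHeadlines (fixTo_updateFinset_of_disjoint)
open ShellMeasureAxialReach (fixTo_comb_eq_one)
open ShellMeasureScalingSUN (windowSU)
open ShellMeasureAxialReachSUN (windowSU_fixTo_comb_eq_one)
open ShellMeasureWilsonGaugeInvariant (exists_gens_of_frozen_eq_one withDensity_univ_ne_top_of_le_one)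
open ShellMeasureWilsonRealizedSUN (MatN plaqWord coe_plaqHol_eq_wordEval wordEval_plaqWord_smul plaqWord_data
  wilsonU measurable_wilsonU measurable_wilsonSum wilsonSum_nonneg wilsonSum_chart_smul)
open ShellMeasureWilsonGaugeInvariantSUN (boxTest giF measurable_giF giF_le_one gaugeInvariant_giF gaugeInvariant_wilsonU
  frozen_eq_one_of_mem_plaqWord continuous_wordEval_plaqWord)
open ShellMeasureWilsonExterior (gaugeInvariant_wilsonWeight gaugeInvariant_mul wilsonSum_updateFinset_of_avoids)
open ShellMeasureRootCompositionSUN (slotAC_realized_suN_of_levelData_ball)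

variable {N : ℕ} [NeZero N] {P : Params} {j : ℕ} [DecidableEq (PBond P j)]

/-! ## §1 The concrete exterior factor: the Wilson weight of plaquettes avoiding the block -/

/-- **THE EXTERIOR WILSON FACTOR IS ADMISSIBLE**: for exterior Wilson plaquettes `P_ext` AVOIDING `Λ` (none of the four
bonds of any of its plaquettes lies in `Λ`) and `β ≥ 0`, `G = e^{−β Σ_{p∈P_ext}(1 − reTr U(∂p))}` on `SU(N)`
configurations is measurable, gauge invariant, `Λ`-blind and `≤ 1` — the hypotheses `hGm`/`hGi`/`hGb`/`hG1` of §2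
(row S2 f2's generic `gaugeInvariant_wilsonWeight` / `wilsonSum_updateFinset_of_avoids` BY NAME). [folklore] -/
theorem exteriorWilson_admissible (Λ : Finset (PBond P j)) {Pext : Finset (Plaq P j)}
    (hPext : ∀ p ∈ Pext, (⟨p.src, p.μ⟩ : PBond P j) ∉ Λ ∧ (⟨p.src.shift p.μ, p.ν⟩ : PBond P j) ∉ Λ ∧
      (⟨p.src.shift p.ν, p.μ⟩ : PBond P j) ∉ Λ ∧ (⟨p.src, p.ν⟩ : PBond P j) ∉ Λ)
    {β : ℝ} (hβ : 0 ≤ β) :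
    (Measurable fun U : GaugeField P j (SUN N) =>
        ENNReal.ofReal (Real.exp (-(β * ∑ p ∈ Pext, (1 - reTr (GaugeField.plaqHol U p)))))) ∧
      (GaugeInvariant fun U : GaugeField P j (SUN N) =>
        ENNReal.ofReal (Real.exp (-(β * ∑ p ∈ Pext, (1 - reTr (GaugeField.plaqHol U p)))))) ∧
      (∀ (U : GaugeField P j (SUN N)) (y : ↥Λ → SUN N),
        ENNReal.ofReal (Real.exp (-(β * ∑ p ∈ Pext, (1 - reTr (GaugeField.plaqHol (updateFinset U Λ y) p))))) =
          ENNReal.ofReal (Real.exp (-(β * ∑ p ∈ Pext, (1 - reTr (GaugeField.plaqHol U p)))))) ∧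
      (∀ U : GaugeField P j (SUN N),
        ENNReal.ofReal (Real.exp (-(β * ∑ p ∈ Pext, (1 - reTr (GaugeField.plaqHol U p))))) ≤ 1) := by
  refine ⟨?_, gaugeInvariant_wilsonWeight β Pext, fun U y => ?_, fun U => ?_⟩
  · exact ENNReal.measurable_ofReal.comp
      (Real.measurable_exp.comp ((measurable_const.mul (measurable_wilsonSum Pext))).neg)
  · rw [wilsonSum_updateFinset_of_avoids Λ hPext]
  · rw [ENNReal.ofReal_le_one, Real.exp_le_one_iff, neg_nonpos]
    exact mul_nonneg hβ (wilsonSum_nonneg Pext U)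

/-! ## §2 (M1)₀ realized for `SU(N)`, gauge-invariant form, with a block-blind exterior factor -/

section Main

/-- **(M1)₀ REALIZED FOR `G = SU(N)`, EVERY `N`, GAUGE-INVARIANT DENSITY, NO BOND WINDOW, WITH A BLOCK-BLIND EXTERIOR
FACTOR.**  Leaf-10's `ShellMeasureWilsonGaugeInvariantSUN.slotAntiConcentration_wilson_suN_gaugeInvariant`
(non-wrapping box `[lo, hi]` of side `≤ m`, chart bonds `Λ` = box bonds off the axial comb, window `0 ≤ S ≤ 1/4`,
co-test threshold `σ > 0` with the `SU(N)` reach `N(d−1)mσ < 4` and `√N(π/2)(d−1)mσ ≤ S`, classifier plaquettes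
`∅ ≠ P_u ⊆ boxPlaqs`, weight plaquettes `P_w`, `β ≥ 0`, `θ > 0`, `0 ≤ δ < 1`, `0 ≤ ρ ≤ (1−δ)/2`, a free radius
`Rad > 1` of the complexified contraction with (SM)₀ `36(e^{4S·Rad} − 1)/(Rad−1)² ≤ δθ`, (SM)_σ `4(4S)²e^{8S} ≤ δσ`) for
the density `G · giF` where `G` is ANY measurable, gauge-invariant, `Λ`-BLIND (`G(U[Λ := y]) = G(U)`) factor with
`G ≤ 1`: SAME conclusion `SlotAntiConcentration ((fieldMeasure P j SU(N)).withDensity (G · giF)) wilsonU θ ρ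
(2(#Λ·d_N + β·#P_w·4S(8+16S))/(1−δ))`.  Proof: END-II for `SU(N)` INHABITED with the level-0 data of the tree-gauged
sections (leaf-10-g7's §4 / S11 §2 word for word), the factor entering the block weight `R V` and the kept co-test
`Jco V` as the section constant `G(V[comb := 1])`.  (M1)₀ realized ≠ NE7c. [folklore] -/
theorem slotAntiConcentration_wilson_suN_gaugeInvariant_exterior
    {lo hi : Fin P.d → ℤ} {m : ℕ} (hN : ∀ κ, hi κ - lo κ < P.sitesPerDir j) (hm : ∀ κ, hi κ ≤ lo κ + m)
    (Λ : Finset (PBond P j)) (hΛbox : ∀ b ∈ Λ, b ∈ boxBonds lo hi)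
    (hΛcomb : Disjoint Λ (combBonds lo hi))
    (hcov : ∀ b ∈ boxBonds lo hi, b ∉ Λ → b ∈ (combBonds lo hi : Finset (PBond P j)))
    {S σ : ℝ} (hS : 0 ≤ S) (hS4 : S ≤ 1 / 4) (hσ : 0 < σ)
    (hN4 : (N : ℝ) * (((P.d - 1 : ℕ) : ℝ) * m * σ) < 4)
    (hrad : Real.sqrt N * (Real.pi / 2 * (((P.d - 1 : ℕ) : ℝ) * m * σ)) ≤ S)
    {Pu : Finset (Plaq P j)} (hPu : Pu.Nonempty) (hPubox : ∀ p ∈ Pu, p ∈ boxPlaqs lo hi)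
    (Pw : Finset (Plaq P j)) {β θ δ ρ Rad : ℝ} (hβ : 0 ≤ β) (hθ : 0 < θ) (hδ0 : 0 ≤ δ) (hδ1 : δ < 1) (hρ0 : 0 ≤ ρ)
    (hρ : ρ ≤ (1 - δ) / 2) (hRad : 1 < Rad)
    (hSM : 36 * (Real.exp (4 * S * Rad) - 1) / (Rad - 1) ^ 2 ≤ δ * θ)
    (hSMσ : 4 * (4 * S) ^ 2 * Real.exp (2 * (4 * S)) ≤ δ * σ)
    (Gx : GaugeField P j (SUN N) → ℝ≥0∞) (hGm : Measurable Gx) (hGi : GaugeInvariant Gx)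
    (hGb : ∀ (U : GaugeField P j (SUN N)) (y : ↥Λ → SUN N), Gx (updateFinset U Λ y) = Gx U)
    (hG1 : ∀ U, Gx U ≤ 1) :
    SlotAntiConcentration ((fieldMeasure P j (SUN N)).withDensity fun U => Gx U * giF lo hi σ β Pw U) (wilsonU hPu)
      θ ρ (2 * (((Λ.card * dimSU N : ℕ) : ℝ) + β * ∑ _p ∈ Pw, (4 * S) * (8 + 4 * (4 * S))) / (1 - δ)) := by
  classical
  have h4S1 : 4 * S ≤ 1 := by linarith
  have hSπ : S ≤ Real.pi := by linarith [Real.pi_gt_three]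
  -- the tree: the axial comb of the non-wrapping box is loop-free
  have hT := noClosedLoop_combBonds (P := P) (j := j) hN
  -- the tree-gauged exterior carries unit letters on the comb
  have hWcomb : ∀ (V : GaugeField P j (SUN N)), ∀ b ∈ boxBonds lo hi, b ∉ Λ →
      fixTo (combBonds lo hi) 1 V b = 1 :=
    fun V b hb hbΛ => fixTo_comb_eq_one lo hi V b (hcov b hb hbΛ)
  -- generator lists of the box plaquette words (comb letters drop out)
  have hgen : ∀ (V : GaugeField P j (SUN N)) (x : BlockChartSU N Λ) (p : Plaq P j), p ∈ boxPlaqs lo hi →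
      ∃ l : List (MatN N), normSum l = sGen (plaqWord Λ (fixTo (combBonds lo hi) 1 V) x p) ∧
        ∀ c : ℝ, wordEval c (plaqWord Λ (fixTo (combBonds lo hi) 1 V) x p) = wordExp (scale c l) :=
    fun V x p hp => exists_gens_of_frozen_eq_one _ (frozen_eq_one_of_mem_plaqWord Λ (hWcomb V) x hp)
  choose! L hLnorm hLeval using hgen
  -- the section of the tree-gauged configuration is the tree-gauged section
  have hsec : ∀ (V : GaugeField P j (SUN N)) (y : ↥Λ → SUN N),
      fixTo (combBonds lo hi) 1 (updateFinset V Λ y) = updateFinset (fixTo (combBonds lo hi) 1 V) Λ y :=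
    fun V y => fixTo_updateFinset_of_disjoint hΛcomb 1 V y
  -- THE BLIND FACTOR IS A SECTION CONSTANT: `G((V[Λ := y])[comb := 1]) = G(V[comb := 1])`
  have hGsec : ∀ (V : GaugeField P j (SUN N)) (y : ↥Λ → SUN N),
      Gx (fixTo (combBonds lo hi) 1 (updateFinset V Λ y)) = Gx (fixTo (combBonds lo hi) 1 V) := fun V y => by
    rw [hsec, hGb]
  -- DICTIONARY for box plaquettes: the plaquette variable at the chart point `c • x` is the scaled word
  have hD1 : ∀ (V : GaugeField P j (SUN N)) (x : BlockChartSU N Λ) (p : Plaq P j), p ∈ boxPlaqs lo hi → ∀ c : ℝ,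
      dist1 (GaugeField.plaqHol (fixTo (combBonds lo hi) 1
        (updateFinset V Λ (expFibreChartSU Λ 1 (c • x)))) p) = ‖wordExp (scale c (L V x p)) - 1‖ := by
    intro V x p hp c
    rw [hsec, ← (wilson_dictionary_specialUnitaryGroup _).2, coe_plaqHol_eq_wordEval, wordEval_plaqWord_smul,
      hLeval V x p hp c]
  have hD1one : ∀ (V : GaugeField P j (SUN N)) (x : BlockChartSU N Λ) (p : Plaq P j), p ∈ boxPlaqs lo hi →
      dist1 (GaugeField.plaqHol (fixTo (combBonds lo hi) 1
        (updateFinset V Λ (expFibreChartSU Λ 1 x))) p) = ‖wordExp (L V x p) - 1‖ := by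
    intro V x p hp
    have h := hD1 V x p hp 1
    rwa [one_smul, scale_one] at h
  -- sizes on the ball: `normSum (L V x p) ≤ 4S`
  have hLsize : ∀ (V : GaugeField P j (SUN N)) (x : BlockChartSU N Λ), x ∈ closedBall (0 : BlockChartSU N Λ) S →
      ∀ p ∈ boxPlaqs lo hi, normSum (L V x p) ≤ 4 * S := by
    intro V x hx p hp
    rw [hLnorm V x p hp]
    exact (plaqWord_data Λ hS (fixTo (combBonds lo hi) 1 V) hx p).2.1
  -- the co-test is CENTRE-MONOTONE on the ball (level-0 core map at threshold σ, every contraction `0 < c ≤ 1`)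
  have hmono : ∀ (V : GaugeField P j (SUN N)) (x : BlockChartSU N Λ), x ∈ closedBall (0 : BlockChartSU N Λ) S →
      ∀ c : ℝ, 0 < c → c ≤ 1 →
      fixTo (combBonds lo hi) 1 (updateFinset V Λ (expFibreChartSU Λ 1 x)) ∈ boxTest lo hi σ →
      fixTo (combBonds lo hi) 1 (updateFinset V Λ (expFibreChartSU Λ 1 (c • x))) ∈ boxTest lo hi σ := by
    intro V x hx c hc0 hc1 hmem p hp
    rw [hD1 V x p hp c]
    have h1 : ‖wordExp (L V x p) - 1‖ < σ := by rw [← hD1one V x p hp]; exact hmem p hp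
    have hs := hLsize V x hx p hp
    have hδc : δ * c ≤ 1 := by nlinarith
    have hcρ : c * (1 + δ * (1 - c)) ≤ 1 - 0 := by nlinarith [mul_nonneg (mul_nonneg hδ0 hc0.le) (sub_nonneg.2 hc1)]
    have h := coreMap_word (L V x p) hc0 hc1 (hs.trans h4S1) hσ
      ((interpConst_mono (normSum_nonneg _) hs).trans hSMσ) hcρ h1
    simpa using h
  -- END-II for `SU(N)` with the level-0 level data; the blind factor rides in `R V` and `Jco V` as `G(V[comb := 1])`
  have h := slotAC_realized_suN_of_levelData_ball (A := MatN N) hT 1 Λ hS hSπ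
    (fun _ => (1 : GaugeField P j (SUN N)))
    (R := fun V y => Gx (fixTo (combBonds lo hi) 1 V) *
      giF lo hi σ β Pw (fixTo (combBonds lo hi) 1 (updateFinset V Λ y)))
    (fun V => measurable_const.mul
      ((measurable_giF lo hi σ β Pw).comp ((measurable_fixTo _ 1).comp measurable_updateFinset)))
    (F := fun U => Gx U * giF lo hi σ β Pw U) (hGm.mul (measurable_giF lo hi σ β Pw))
    (gaugeInvariant_mul hGi (gaugeInvariant_giF lo hi σ β Pw)) ?hFw
    (fun V => withDensity_univ_ne_top_of_le_one (blockLaw Λ) fun y =>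
      mul_le_one' (hG1 _) (giF_le_one lo hi hβ Pw _))
    (measurable_wilsonU hPu) (gaugeInvariant_wilsonU hPu)
    (matrixTrace (n := Fin N)) matrixTrace_N_pos hPu
    (fun V p x => wordEval 1 (plaqWord Λ (fixTo (combBonds lo hi) 1 V) x p))
    (fun V p _ => continuous_wordEval_plaqWord Λ _ p 1) Pw
    (fun V p x => wordEval 1 (plaqWord Λ (fixTo (combBonds lo hi) 1 V) x p)) (fun _ _ => (0 : ℝ))
    (fun _ => closedBall (0 : BlockChartSU N Λ) S)
    (fun V x => Gx (fixTo (combBonds lo hi) 1 V) * ((closedBall (0 : BlockChartSU N Λ) S).indicator 1 x *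
      (boxTest lo hi σ).indicator 1 (fixTo (combBonds lo hi) 1 (updateFinset V Λ (expFibreChartSU Λ 1 x)))))
    (θ := θ) (δ := δ) (ρ := ρ) (β := β) (Rad := Rad) (H := Real.exp (4 * S * Rad) - 1) (B𝓔 := 0)
    (sw := fun _ => 4 * S) (lw := fun _ => 4 * S) (dw := fun _ => 8)
    ?hRdict ?hudict ?hJW ?hJ hRad ?hAN ?hGW (fun _ _ => h4S1) (fun _ _ => by positivity) (fun _ _ => by positivity)
    (fun _ _ => by norm_num) ?hE le_rfl hθ hδ0 hδ1 hρ0 hρ hβ ?hSM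
  · simpa only [add_zero] using h
  case hFw =>
    -- (LR)₀: the window factorisation is IMPLIED (S43's reach, exactly as in leaf-10's gauge-invariant face)
    intro V y
    by_cases hmem : fixTo (combBonds lo hi) 1 (updateFinset V Λ y) ∈ boxTest lo hi σ
    · have hwin : windowSU Λ (1 : GaugeField P j (SUN N)) S
          (fun b : ↥Λ => fixTo (combBonds lo hi) 1 (updateFinset V Λ y) b) = 1 :=
        windowSU_fixTo_comb_eq_one _ (S₀ := (boxPlaqs lo hi : Set (Plaq P j))) subset_rfl hmem hσ.le hm hN4 hrad Λ
          hΛbox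
      have hy : (fun b : ↥Λ => fixTo (combBonds lo hi) 1 (updateFinset V Λ y) b) = y := by
        funext b
        have hbT : (b : PBond P j) ∉ combBonds lo hi := Finset.disjoint_left.1 hΛcomb b.2
        simp [fixTo, updateFinset, b.2, hbT]
      rw [hy] at hwin
      rw [hwin, one_mul, hGsec]
    · have h0 : giF lo hi σ β Pw (fixTo (combBonds lo hi) 1 (updateFinset V Λ y)) = 0 := by
        unfold giF; rw [indicator_of_notMem hmem, zero_mul]
      rw [h0, mul_zero, mul_zero, mul_zero]
  case hRdict =>
    -- the block weight on the chart ball IS (section constant × co-test) × Wilson weight of the sectioned words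
    intro V x hx
    simp only [indicator_of_mem hx, Pi.one_apply, one_mul]
    unfold giF weight action
    have hsum := wilsonSum_chart_smul Λ Pw (fixTo (combBonds lo hi) 1 V) x 1
    rw [one_smul] at hsum
    rw [add_zero, hsec, hsum, ← hsec, mul_assoc]
  case hudict =>
    -- the classifier of the tree-gauged section IS `max_p ‖word_p − 1‖` (an identity at EVERY chart point)
    intro V x _
    unfold wilsonU classifier
    refine Finset.sup'_congr hPu rfl fun p _ => ?_
    rw [hsec, ← (wilson_dictionary_specialUnitaryGroup _).2, coe_plaqHol_eq_wordEval]
  case hJW =>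
    intro V x hJx
    by_contra hx
    exact hJx (by rw [indicator_of_notMem hx, zero_mul, mul_zero])
  case hJ =>
    intro V x a ha
    refine mul_le_mul' le_rfl ?_
    have hc0 : 0 < Real.exp (-a) := Real.exp_pos _
    have hc1 : Real.exp (-a) ≤ 1 := by rw [Real.exp_le_one_iff]; linarith
    by_cases hx : x ∈ closedBall (0 : BlockChartSU N Λ) S
    · by_cases hmem : fixTo (combBonds lo hi) 1 (updateFinset V Λ (expFibreChartSU Λ 1 x)) ∈ boxTest lo hi σ
      · have hx' : Real.exp (-a) • x ∈ closedBall (0 : BlockChartSU N Λ) S :=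
          smul_mem_closedBall_zero hx hc0.le hc1
        have hmem' := hmono V x hx (Real.exp (-a)) hc0 hc1 hmem
        rw [indicator_of_mem hx, indicator_of_mem hx', indicator_of_mem hmem, indicator_of_mem hmem']
        simp only [Pi.one_apply, mul_one, le_refl]
      · rw [indicator_of_notMem hmem, mul_zero]
        exact bot_le
    · rw [indicator_of_notMem hx, zero_mul]
      exact bot_le
  case hAN =>
    -- (AN-bound)₀: the plaquette functional of the LINEAR bond rays, `H = e^{4S·Rad} − 1`
    intro V x hx p hp
    obtain ⟨f, hf, hb, h0, hc⟩ := classifierWitness_linear (L V x p) Rad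
    refine ⟨f, hf, fun w hw => (hb w hw).trans ?_, h0, fun c' h1 h2 => ?_⟩
    · have hs := hLsize V x hx p (hPubox p hp)
      have hR0 : 0 ≤ Rad := by linarith
      apply sub_le_sub_right
      apply Real.exp_le_exp.2
      nlinarith
    · rw [hc c' h1 h2]
      show wordExp (scale c' (L V x p)) - 1 =
        wordEval 1 (plaqWord Λ (fixTo (combBonds lo hi) 1 V) (c' • x) p) - 1
      rw [wordEval_plaqWord_smul, hLeval V x p (hPubox p hp) c']
  case hGW =>
    -- graded sectioned words moving LINEARLY: `s̄ = L̄ = 4S`, `d̄ = 8`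
    intro V x hx p _
    obtain ⟨hgood, hs, hd⟩ := plaqWord_data Λ hS (fixTo (combBonds lo hi) 1 V) hx p
    obtain ⟨gw, hg, hss, hls, hmd, hev⟩ := exists_graded_of_word (matrixTrace (n := Fin N)) _ hgood
    refine ⟨gw, hg, hss ▸ hs, hls ▸ hs, hmd ▸ hd, fun c' _ _ => ?_⟩
    show mwordEval c' (gw.map Prod.fst) = wordEval 1 (plaqWord Λ (fixTo (combBonds lo hi) 1 V) (c' • x) p)
    rw [hev c', wordEval_plaqWord_smul]
  case hE =>
    intro V x _ c' _ _
    simp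
  case hSM =>
    simpa only [one_pow, mul_one] using hSM

/-- **… WITH THE EXTERIOR WILSON WEIGHT** — the instance `G = e^{−β Σ_{p∈P_ext}(1 − reTr U(∂p))}` for exterior
plaquettes `P_ext` AVOIDING `Λ` (§1): (M1)₀ for the density `e^{−β Σ_{P_ext}} · 1[box σ-small] · e^{−β Σ_{P_w}}`,
same constant — the input of file 2's on-shell transfer to the full Gibbs law. [folklore] -/
theorem slotAntiConcentration_wilson_suN_gaugeInvariant_exteriorWilson
    {lo hi : Fin P.d → ℤ} {m : ℕ} (hN : ∀ κ, hi κ - lo κ < P.sitesPerDir j) (hm : ∀ κ, hi κ ≤ lo κ + m)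
    (Λ : Finset (PBond P j)) (hΛbox : ∀ b ∈ Λ, b ∈ boxBonds lo hi)
    (hΛcomb : Disjoint Λ (combBonds lo hi))
    (hcov : ∀ b ∈ boxBonds lo hi, b ∉ Λ → b ∈ (combBonds lo hi : Finset (PBond P j)))
    {S σ : ℝ} (hS : 0 ≤ S) (hS4 : S ≤ 1 / 4) (hσ : 0 < σ)
    (hN4 : (N : ℝ) * (((P.d - 1 : ℕ) : ℝ) * m * σ) < 4)
    (hrad : Real.sqrt N * (Real.pi / 2 * (((P.d - 1 : ℕ) : ℝ) * m * σ)) ≤ S)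
    {Pu : Finset (Plaq P j)} (hPu : Pu.Nonempty) (hPubox : ∀ p ∈ Pu, p ∈ boxPlaqs lo hi)
    (Pw Pext : Finset (Plaq P j)) {β θ δ ρ Rad : ℝ} (hβ : 0 ≤ β) (hθ : 0 < θ) (hδ0 : 0 ≤ δ) (hδ1 : δ < 1)
    (hρ0 : 0 ≤ ρ) (hρ : ρ ≤ (1 - δ) / 2) (hRad : 1 < Rad)
    (hSM : 36 * (Real.exp (4 * S * Rad) - 1) / (Rad - 1) ^ 2 ≤ δ * θ)
    (hSMσ : 4 * (4 * S) ^ 2 * Real.exp (2 * (4 * S)) ≤ δ * σ)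
    (hPext : ∀ p ∈ Pext, (⟨p.src, p.μ⟩ : PBond P j) ∉ Λ ∧ (⟨p.src.shift p.μ, p.ν⟩ : PBond P j) ∉ Λ ∧
      (⟨p.src.shift p.ν, p.μ⟩ : PBond P j) ∉ Λ ∧ (⟨p.src, p.ν⟩ : PBond P j) ∉ Λ) :
    SlotAntiConcentration
      ((fieldMeasure P j (SUN N)).withDensity fun U =>
        ENNReal.ofReal (Real.exp (-(β * ∑ p ∈ Pext, (1 - reTr (GaugeField.plaqHol U p))))) *
          giF lo hi σ β Pw U)
      (wilsonU hPu) θ ρ (2 * (((Λ.card * dimSU N : ℕ) : ℝ) + β * ∑ _p ∈ Pw, (4 * S) * (8 + 4 * (4 * S))) / (1 - δ)) := by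
  obtain ⟨hGm, hGi, hGb, hG1⟩ := exteriorWilson_admissible (N := N) Λ hPext hβ
  exact slotAntiConcentration_wilson_suN_gaugeInvariant_exterior hN hm Λ hΛbox hΛcomb hcov hS hS4 hσ hN4 hrad hPu hPubox
    Pw hβ hθ hδ0 hδ1 hρ0 hρ hRad hSM hSMσ _ hGm hGi hGb hG1

end Main

end Summit.QuantumFields.BalabanUV.T4Continuum.ShellMeasureWilsonExteriorSUN

end
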